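import Summits.CriticalPhenomena.PercolationContinuityZ3.Theorems.PercAnnulusCrossingIICLocalLimitPlanar
import Summits.CriticalPhenomena.PercolationContinuityZ3.Theorems.PercNearOneGluingNoHeavyQuantZ2PolyDecay
import HarnessLib

/-!
# A polynomial rate for the planar IIC local limit: `|ν(E) − P_{1/2}(E)| ≤ C · Σ_{w} ‖w‖_∞^{−c}` (lane RSW3, p1 gen 7)

builds on p205010 (kernel theorem, internal audit signed; external expert review pending) — NOT used by the statements of this file
(`ℤ²`, unconditional: Harris–Kesten, RSW, Bollobás–Riordan's annulus constant).

Seat `prim-rsw3-p1` (gen 7).  `PercAnnulusCrossingIICLocalLimitPlanar.lean` bounds the total-variation distance between Kesten's IIC measure `ν`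
on `ℤ²` and `P_{1/2}` on the events of a finite edge set with endpoints `W` by `C · Σ_{w ∈ W} π_{1/2}(‖w‖_∞)`; the lane's explicit one-arm decay
`Quant.oneArmPolyDecayAtCritical_two` (`π_{p_c(ℤ²)}(n) ≤ 2 · n^{−2^{−158}}`, Bollobás–Riordan) turns this into an EXPLICIT POLYNOMIAL RATE:

* **`iicMeasure_abs_real_sub_le_rpow_Z2`** — `∃ C > 0 ∀ ν ∀ F W E` (endpoints of `F` in `W`, all `w ∈ W` nonzero):
  **`|ν(E) − P_{1/2}(E)| ≤ C · Σ_{w ∈ W} ‖w‖_∞^{−2^{−158}}`**;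
* **`iicMeasure_abs_real_sub_le_mul_rpow_Z2`** — uniform form: if `W` has at most `M` points, all outside `Λ(n)`, then
  **`|ν(E) − P_{1/2}(E)| ≤ C · M · (n+1)^{−2^{−158}}`**.

Helper file for the crux `stmt-CriticalPhenomena-4575` chain; no definitions, no sorries.
References: H. Kesten, PTRF 73 (1986) 369–394, (1.12)–(1.13); B. Bollobás, O. Riordan, *Percolation* (2006), Ch. 3, Thm. 6, eq. (5).
-/

noncomputable section

namespace Summit.CriticalPhenomena.PercolationContinuityZ3.Theorems.Crossing

open MeasureTheory ProbabilityTheory Filter Topology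
open Literature.Probability.Percolation Literature.Probability.LatticeModels
open Literature.Probability.Percolation.DCT16
open scoped ENNReal ProbabilityTheory Literature.Probability.Percolation

/-- **EXPLICIT POLYNOMIAL RATE FOR THE PLANAR IIC LOCAL LIMIT**: there is `C > 0` such that for every measure `ν` with Kesten's IIC limit property
at `p_c(ℤ²)`, every finite edge set `F` whose endpoints lie in a finite set `W` of nonzero sites, and every event `E` determined by `F`:
**`|ν(E) − P_{1/2}(E)| ≤ C · Σ_{w ∈ W} ‖w‖_∞^{−2^{−158}}`**. [cite: Kesten1986, (1.12)–(1.13)] [cite: BollobasRiordan2006, Ch. 3, Thm. 6, eq. (5)] -/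
theorem iicMeasure_abs_real_sub_le_rpow_Z2 :
    ∃ C : ℝ, 0 < C ∧ ∀ (ν : Measure (BondConfig (Site 2))),
      (∀ (F : Finset (Sym2 (Site 2))) (E : Set (BondConfig (Site 2))), MeasurableSet E → DeterminedBy E ↑F →
        Tendsto (fun n : ℕ => (bondPercolation (zdGraph 2) (criticalProbI 2)).real (E ∩ siteToBoundary 2 n) /
          oneArmProb 2 (criticalProbI 2) n) atTop (𝓝 (ν.real E))) →
      ∀ (F : Finset (Sym2 (Site 2))) (W : Finset (Site 2)) (E : Set (BondConfig (Site 2))),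
        (∀ e ∈ F, ∀ w ∈ e, w ∈ W) → (∀ w ∈ W, 1 ≤ Site.supNorm w) → DeterminedBy E ↑F →
        |ν.real E - (bondPercolation (zdGraph 2) (criticalProbI 2)).real E| ≤
          C * ∑ w ∈ W, (Site.supNorm w : ℝ) ^ (-((2 : ℝ)⁻¹ ^ 158)) := by
  obtain ⟨C, hC, hb⟩ := iicMeasure_abs_real_sub_le_Z2
  refine ⟨2 * C, by positivity, fun ν hν F W E hFW hW hE => ?_⟩
  refine (hb ν hν F W E hFW hE).trans ?_
  calc C * ∑ w ∈ W, oneArmProb 2 (criticalProbI 2) (Site.supNorm w)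
      ≤ C * ∑ w ∈ W, 2 * (Site.supNorm w : ℝ) ^ (-((2 : ℝ)⁻¹ ^ 158)) := by
        refine mul_le_mul_of_nonneg_left (Finset.sum_le_sum fun w hw => ?_) hC.le
        exact Quant.oneArmPolyDecayAtCritical_two (Site.supNorm w) (hW w hw)
    _ = 2 * C * ∑ w ∈ W, (Site.supNorm w : ℝ) ^ (-((2 : ℝ)⁻¹ ^ 158)) := by
        rw [← Finset.mul_sum]
        ring

/-- **Uniform form**: with the same `C`, if `W` has at most `M` points, all outside `Λ(n)`, then
**`|ν(E) − P_{1/2}(E)| ≤ C · M · (n + 1)^{−2^{−158}}`** — the planar IIC seen through a window of `M` sites at sup-distance `> n` from its root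
differs from critical percolation by at most `C M (n+1)^{−2^{−158}}` in total variation. [cite: Kesten1986, (1.12)–(1.13)]
[cite: BollobasRiordan2006, Ch. 3, Thm. 6, eq. (5)] -/
theorem iicMeasure_abs_real_sub_le_mul_rpow_Z2 :
    ∃ C : ℝ, 0 < C ∧ ∀ (ν : Measure (BondConfig (Site 2))),
      (∀ (F : Finset (Sym2 (Site 2))) (E : Set (BondConfig (Site 2))), MeasurableSet E → DeterminedBy E ↑F →
        Tendsto (fun n : ℕ => (bondPercolation (zdGraph 2) (criticalProbI 2)).real (E ∩ siteToBoundary 2 n) /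
          oneArmProb 2 (criticalProbI 2) n) atTop (𝓝 (ν.real E))) →
      ∀ (F : Finset (Sym2 (Site 2))) (W : Finset (Site 2)) (E : Set (BondConfig (Site 2))) (M n : ℕ),
        (∀ e ∈ F, ∀ w ∈ e, w ∈ W) → W.card ≤ M → (∀ w ∈ W, w ∉ box 2 n) → DeterminedBy E ↑F →
        |ν.real E - (bondPercolation (zdGraph 2) (criticalProbI 2)).real E| ≤
          C * M * ((n : ℝ) + 1) ^ (-((2 : ℝ)⁻¹ ^ 158)) := by
  obtain ⟨C, hC, hb⟩ := iicMeasure_abs_real_sub_le_rpow_Z2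
  refine ⟨C, hC, fun ν hν F W E M n hFW hcard hfar hE => ?_⟩
  have hnorm : ∀ w ∈ W, n + 1 ≤ Site.supNorm w := fun w hw => by
    by_contra h'
    push Not at h'
    exact hfar w hw (mem_box_iff_supNorm_le.2 (by omega))
  have hW1 : ∀ w ∈ W, 1 ≤ Site.supNorm w := fun w hw => le_trans (by omega) (hnorm w hw)
  refine (hb ν hν F W E hFW hW1 hE).trans ?_
  have hc0 : 0 < (2 : ℝ)⁻¹ ^ 158 := by positivity
  have hterm : ∀ w ∈ W, (Site.supNorm w : ℝ) ^ (-((2 : ℝ)⁻¹ ^ 158)) ≤ ((n : ℝ) + 1) ^ (-((2 : ℝ)⁻¹ ^ 158)) := by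
    intro w hw
    have h1 : ((n : ℝ) + 1) ≤ (Site.supNorm w : ℝ) := by exact_mod_cast hnorm w hw
    have h0 : (0 : ℝ) < (n : ℝ) + 1 := by positivity
    exact Real.rpow_le_rpow_of_nonpos h0 h1 (by linarith)
  calc C * ∑ w ∈ W, (Site.supNorm w : ℝ) ^ (-((2 : ℝ)⁻¹ ^ 158))
      ≤ C * ∑ _w ∈ W, ((n : ℝ) + 1) ^ (-((2 : ℝ)⁻¹ ^ 158)) := mul_le_mul_of_nonneg_left (Finset.sum_le_sum hterm) hC.le
    _ = C * (W.card * ((n : ℝ) + 1) ^ (-((2 : ℝ)⁻¹ ^ 158))) := by rw [Finset.sum_const, nsmul_eq_mul]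
    _ ≤ C * (M * ((n : ℝ) + 1) ^ (-((2 : ℝ)⁻¹ ^ 158))) := by
        refine mul_le_mul_of_nonneg_left (mul_le_mul_of_nonneg_right (by exact_mod_cast hcard) ?_) hC.le
        exact Real.rpow_nonneg (by positivity) _
    _ = C * M * ((n : ℝ) + 1) ^ (-((2 : ℝ)⁻¹ ^ 158)) := by ring

end Summit.CriticalPhenomena.PercolationContinuityZ3.Theorems.Crossing

end
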